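import Summits.BirchSwinnertonDyer.Rank1Residual.X11b.MultiplicativeDivisibility
import HarnessLib

/-!
# BSD rank-≤1 residual cell, class X11b with a (ram) prime at `p ≥ 3`: the named per-pair consumers
# (Skinner 2016 Thm. A ∘ the typed divisibility input ∘ the p-adic certificate engine)

HONEST FRAMING (cell `b2b-bsdres-*`, verbatim): prove what is provable now; shrink each hard class
to its core with data; no claim beyond stated classes. Theorems only; per pair; X11b stays
CONSTRUCTION-SHAPED; no named fact; nothing booked by this file.

Unit `b2b-bsdres-x11c`, gen 5. Companion of `X11b/MultiplicativeDivisibility.lean` (p204242 /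
p204957): the two one-line corollaries `ClassX11b.bsdp_of_ram_{split,nonsplit}_of_certificate` =
`ClassX11b.bsdp_of_multDivisibilityAt_{split,nonsplit}_of_certificate` with the divisibility SUPPLIED by
`multDivisibilityAt_of_ram` (A31). They are the kernel consumers cited per pair for the 56 SEMISTABLE
X11b rank-one `p ≥ 5` in-window pairs (the former C4 / T-CAS domain — all (ram), `E[p]` irreducible,
`#Ш_an = 1`; HOME/b2b-bsdres-x11c/gen5/sst56/SST56-ADDENDUM.md, two-engine certificates 56/56) and
equally valid for the 74 (ram) pairs among the unit's 85 ¬sst records. No semistability hypothesis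
either way and no v3 `ClassX11` predicate (which excludes `sst ∧ ram ∧ r = 1`, the Partition's F1
finding). References: Skinner 2016 Thm. A [Skinner2016PacificMC]; Stein–Wuthrich 2013 Thm. 6.1, §4.2
[SteinWuthrich2013]; Miller 2011 Prop. 7.6 [Miller2011LMS].
-/

set_option autoImplicit false

noncomputable section

open scoped Classical MatrixGroups ModularForm

open CongruenceSubgroup WeierstrassCurve Literature.NumberTheory.EllipticCurves
  Literature.NumberTheory.EllipticCurves.ModularForms
  Literature.NumberTheory.EllipticCurves.Rank1Residual
  Literature.NumberTheory.EllipticCurves.Rank1Residual.Typed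
  Literature.NumberTheory.EllipticCurves.Skinner2016
  Literature.NumberTheory.EllipticCurves.Wuthrich2014
  Literature.NumberTheory.EllipticCurves.SteinWuthrich2013

namespace Summit.BirchSwinnertonDyer.Rank1Residual.X11b

/-! ### Named corollaries for the (ram) locus — the consumer cited per pair for the
56 SEMISTABLE X11b rank-one `p ≥ 5` in-window pairs (former C4 / T-CAS domain; all (ram), `E[p]`
irreducible, `#Ш_an = 1`; HOME/b2b-bsdres-x11c/gen5/sst56/SST56-ADDENDUM.md) -/

/-- **Class X11b with a (ram) prime, SPLIT multiplicative `p ≥ 3`: Skinner 2016 Thm. A (A31) + SW13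
Thm. 6.1 (A37) + §4.2 height existence (A38) + GZK (A18) + the two-number certificate + `p ∤ #Ш_an` ⟹
`BSD(E,p)`** — `ClassX11b.bsdp_of_multDivisibilityAt_split_of_certificate` with the divisibility
SUPPLIED by `multDivisibilityAt_of_ram`. No semistability / non-semistability hypothesis, no class-X11
(v3) predicate: it covers the 56 semistable former-T-CAS pairs and the 74 (ram) pairs among the 85
¬sst records alike. Per pair; X11b stays CONSTRUCTION-SHAPED.
[cite: Skinner2016PacificMC, Thm. A (§1), §3.2] [cite: SteinWuthrich2013, Thm. 6.1 (p. 20) and §4.2] -/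
theorem ClassX11b.bsdp_of_ram_split_of_certificate (hA : thmA_charIdeal_multiplicative)
    (hJ : thm61_splitMultiplicative) (hH : exists_isSplitMultCanonical)
    (hGZK : rank_eq_analyticRank_of_analyticRank_le_one)
    (W : WeierstrassCurve ℚ) [W.IsElliptic] [W.IsGloballyMinimal] (p : ℕ) [Fact p.Prime]
    {κ : ZpExtension ℚ p} {γ : Field.absoluteGaloisGroup ℚ} {N : ℕ} [NeZero N]
    {f : CuspForm (Gamma0 N) 2} (hp : 3 ≤ p) (hX : ClassX11b W p) (hram : Ram W p)
    (Dq : TateParameterData W p)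
    (hκ : κ.IsCyclotomic) (hγ : κ.IsTopGenerator γ) (hγ' : IsCyclotomicVariable p γ)
    (hf : IsNewformOf W f) (D : W.SelmerDualData κ γ) (ϖ : ℚ) (hϖ0 : ϖ ≠ 0)
    (hϖ : (ϖ : ℝ) * W.realPeriodRat = plusPeriod f)
    (L : PowerSeries ℚ_[p]) (hL : IsSplitMultPAdicLFunctionOf f p L)
    (hordL : L.order = (W.mordellWeilRank + 1 : ℕ))
    (hcert : ∀ Dh : PAdicHeightData W p, IsSplitMultCanonical Dh Dq →
      (((ϖ : ℚ) : ℚ_[p]) * PowerSeries.coeff (W.mordellWeilRank + 1) L *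
          (padicLog p (cyclotomicGenerator p) ^ (W.mordellWeilRank + 1) *
            (W.torsionOrder : ℚ_[p]) ^ 2)).valuation =
        (LInvariant Dq * (W.tamagawaProduct : ℚ_[p]) * padicRegulator Dh).valuation)
    {s : ℚ} (hs : shaAn W = (s : ℂ)) (hv : padicValRat p s = 0) : BSDp W p :=
  X11b.ClassX11b.bsdp_of_multDivisibilityAt_split_of_certificate hJ hH hGZK W p hp hX
    (multDivisibilityAt_of_ram hA hp hX.2.2.1 hX.2.2.2 hram) Dq hκ hγ hγ' hf D ϖ hϖ0 hϖ L hL hordL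
    hcert hs hv

/-- **Class X11b with a (ram) prime, NON-split multiplicative `p ≥ 3`**: the same from the non-split
clause (`e = 0`, `ε_p = 2`). Per pair. [cite: Skinner2016PacificMC, Thm. A (§1), §3.2]
[cite: SteinWuthrich2013, Thm. 6.1 (p. 20), §3.1 (p. 9) and §4.2] -/
theorem ClassX11b.bsdp_of_ram_nonsplit_of_certificate (hA : thmA_charIdeal_multiplicative)
    (hJ : thm61_nonsplitMultiplicative) (hH : exists_isMultCanonical)
    (hGZK : rank_eq_analyticRank_of_analyticRank_le_one)
    (W : WeierstrassCurve ℚ) [W.IsElliptic] [W.IsGloballyMinimal] (p : ℕ) [Fact p.Prime]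
    {κ : ZpExtension ℚ p} {γ : Field.absoluteGaloisGroup ℚ} {N : ℕ} [NeZero N]
    {f : CuspForm (Gamma0 N) 2} (hp : 3 ≤ p) (hX : ClassX11b W p) (hram : Ram W p)
    (hns : ¬ W.HasSplitMultiplicativeReductionAtPrime p)
    {q : ℚ_[p]} (hq0 : q ≠ 0) (hq1 : ‖q‖ < 1) (hqj : tateJ q = (W.j : ℚ_[p]))
    (hκ : κ.IsCyclotomic) (hγ : κ.IsTopGenerator γ) (hγ' : IsCyclotomicVariable p γ)
    (hf : IsNewformOf W f) (D : W.SelmerDualData κ γ) (ϖ : ℚ) (hϖ0 : ϖ ≠ 0)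
    (hϖ : (ϖ : ℝ) * W.realPeriodRat = plusPeriod f)
    (L : PowerSeries ℚ_[p]) (hL : IsMultPAdicLFunctionOf f p (-1) L)
    (hordL : L.order = (W.mordellWeilRank : ℕ))
    (hcert : ∀ Dh : PAdicHeightData W p, IsMultCanonical Dh q →
      (((ϖ : ℚ) : ℚ_[p]) * PowerSeries.coeff W.mordellWeilRank L *
          (padicLog p (cyclotomicGenerator p) ^ W.mordellWeilRank *
            (W.torsionOrder : ℚ_[p]) ^ 2)).valuation =
        (2 * (W.tamagawaProduct : ℚ_[p]) * padicRegulator Dh).valuation)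
    {s : ℚ} (hs : shaAn W = (s : ℂ)) (hv : padicValRat p s = 0) : BSDp W p :=
  X11b.ClassX11b.bsdp_of_multDivisibilityAt_nonsplit_of_certificate hJ hH hGZK W p hp hX
    (multDivisibilityAt_of_ram hA hp hX.2.2.1 hX.2.2.2 hram) hns hq0 hq1 hqj hκ hγ hγ' hf D ϖ hϖ0 hϖ
    L hL hordL hcert hs hv

end Summit.BirchSwinnertonDyer.Rank1Residual.X11b

end
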